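import Summits.MatrixMultiplication.MatrixMultiplication.Theses.LevelGradedCohnUmans
import Summits.MatrixMultiplication.MatrixMultiplication.Theorems.GradedPricing.Negative.LoadBearing
import Summits.MatrixMultiplication.MatrixMultiplication.Theorems.GradedPricing.Negative.LeftInvariance

/-!
# `GradedPricing` (crux `stmt-MatrixMultiplication-7611`, route `LevelGradedCohnUmans`):
# right-invariance of the test space alone does not suffice (negative-side support, cycle 2)

Mirror of `Negative/LeftInvariance.lean` (which treats LEFT-invariant `J`).  In `𝔖₃`, the ROW
space `J_row = ℂ ρ₁₁ ⊕ ℂ ρ₁₂` of the 2-dimensional irreducible representation (tables `r11`,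
`r12`, `r21`, `r22` of `LeftInvariance`) is RIGHT-invariant (`rightInvariant_Jrow`), separates the
triple `({1},{1},{1})` by `ρ₁₁` (`ρ₁₁(1) = 1`), and contains no irreducible character
(`irrChars_inter_Jrow`: a class function `α ρ₁₁ + β ρ₁₂` must vanish), so its graded budget is `0`
against a volume term `1`: `gradedPricing_false_with_rightInv_only`.  Together with the left-handed
witness: NEITHER one-sided ideal structure of `J^⊥` is enough for the crux; its (kernel-checked)
proof uses both sides (matrix-unit sandwich `E_ac P E_cb`).  Everything `sorry`-free.
-/

noncomputable section

set_option linter.dupNamespace false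

open scoped BigOperators
open Literature.RepresentationTheory.FiniteGroups Literature.Computability.AlgebraicComplexity

namespace Summit.MatrixMultiplication.MatrixMultiplication.Theorems.GradedPricing.Negative

/-- Rows transform on the right: `ρ(g a)_{1j} = Σ_k ρ(g)_{1k} ρ(a)_{kj}` (all 36 pairs). [folklore] -/
theorem row_mul : ∀ g a : S₃,
    r11 (g * a) = r11 g * r11 a + r12 g * r21 a ∧ r12 (g * a) = r11 g * r12 a + r12 g * r22 a := by
  decide

/-- Values of `ρ₁₂` used in the class-function test. [folklore] -/
theorem table_facts_row : r12 1 = 0 ∧ r12 c3 = -1 ∧ r12 (c3 * c3) = 1 ∧ r12 s01 = 1 ∧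
    r12 s12 = 0 := by decide

/-- Second entry of the first ROW of the 2-dimensional irrep, as a complex function (notation,
not a definition). -/
local notation "f₁₂" => (fun σ : S₃ => ((r12 σ : ℤ) : ℂ))

/-- The row space `J_row = ℂ f₁ ⊕ ℂ f₁₂` (`f₁ = ρ₁₁`, `f₁₂ = ρ₁₂`; notation). -/
local notation "Jrow" => (Submodule.span ℂ ({f₁, f₁₂} : Set (S₃ → ℂ)))

/-- `J_row` is RIGHT-invariant (`f ↦ f(·a)`). [folklore] -/
theorem rightInvariant_Jrow : ∀ f ∈ Jrow, ∀ a : S₃, (fun g => f (g * a)) ∈ Jrow := by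
  intro f hf a
  obtain ⟨α, β, rfl⟩ := Submodule.mem_span_pair.mp hf
  refine Submodule.mem_span_pair.mpr ⟨α * r11 a + β * r12 a, α * r21 a + β * r22 a, ?_⟩
  funext g
  have h := row_mul g a
  simp only [Pi.add_apply, Pi.smul_apply, smul_eq_mul, f₁]
  rw [h.1, h.2]
  push_cast
  ring

/-- No irreducible character of `𝔖₃` lies in `J_row` (class-function test on the conjugate pairs
`(c3, c3²)` and `(s01, s12)` forces `α = β = 0`, but `χ(1) ≠ 0`). [folklore] -/
theorem irrChars_inter_Jrow : irrChars S₃ ∩ (Jrow : Set (S₃ → ℂ)) = ∅ := by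
  ext χ
  simp only [Set.mem_inter_iff, SetLike.mem_coe, Set.mem_empty_iff_false, iff_false, not_and]
  intro hχ hJ
  obtain ⟨α, β, rfl⟩ := Submodule.mem_span_pair.mp hJ
  have hirr := hχ
  obtain ⟨V, _, _, _, ρ, hρ, hchar⟩ := hχ
  have hc1 : ρ.character (s01 * c3 * s01⁻¹) = ρ.character c3 := Representation.char_conj ρ c3 s01
  have hc2 : ρ.character (c3 * s01 * c3⁻¹) = ρ.character s01 := Representation.char_conj ρ s01 c3
  rw [← conj_facts.1] at hc1
  rw [← conj_facts.2] at hc2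
  rw [hchar] at hc1 hc2
  obtain ⟨-, -, t3, -, t5, -, t7, -, t9, -⟩ := table_facts
  obtain ⟨-, u2, u3, u4, u5⟩ := table_facts_row
  simp only [Pi.add_apply, Pi.smul_apply, smul_eq_mul, f₁, t3, t5, t7, t9, u2, u3, u4, u5]
    at hc1 hc2
  push_cast at hc1 hc2
  have hα : α = 0 := by linear_combination ((1:ℂ)/3) * hc1 + ((2:ℂ)/3) * hc2
  have hβ : β = 0 := by linear_combination ((2:ℂ)/3) * hc1 + ((1:ℂ)/3) * hc2
  apply apply_one_ne_zero hirr
  simp [hα, hβ]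

/-- **Right-invariance alone does not suffice for `GradedPricing`**: with bi-invariance weakened to
right-invariance the statement is FALSE (`G = 𝔖₃`, `J = J_row`, `X = Y = Z = {1}`: separated by
`f₁ = ρ₁₁`, volume term `1`, graded budget `0`). [folklore] -/
theorem gradedPricing_false_with_rightInv_only :
    ¬ ∀ (G : Type) [Group G] [Fintype G] (J : Submodule ℂ (G → ℂ)),
      (∀ f ∈ J, ∀ a : G, (fun g : G => f (g * a)) ∈ J) → ∀ X Y Z : Finset G,
      (∀ x₀ ∈ X, ∀ z₀ ∈ Z, ∃ f ∈ J, ∀ x ∈ X, ∀ y ∈ Y, ∀ y' ∈ Y, ∀ z ∈ Z,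
        (x = x₀ ∧ y = y' ∧ z = z₀ → f (x⁻¹ * y * y'⁻¹ * z) = 1) ∧
        (¬ (x = x₀ ∧ y = y' ∧ z = z₀) → f (x⁻¹ * y * y'⁻¹ * z) = 0)) →
      ((X.card * Y.card * Z.card : ℕ) : ℝ) ^ (omega ℂ / 3) ≤
        ∑ᶠ χ ∈ irrChars G ∩ (J : Set (G → ℂ)), (χ 1).re ^ omega ℂ := by
  intro h
  have hle := h S₃ Jrow rightInvariant_Jrow {1} {1} {1} (by
    intro x₀ hx₀ z₀ hz₀
    refine ⟨f₁, Submodule.subset_span (Set.mem_insert _ _), ?_⟩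
    intro x hx y hy y' hy' z hz
    simp only [Finset.mem_singleton] at hx hy hy' hz hx₀ hz₀
    subst hx hy hy' hz hx₀ hz₀
    refine ⟨fun _ => ?_, fun hne => absurd ⟨rfl, rfl, rfl⟩ hne⟩
    simp [f₁, table_facts.1])
  rw [irrChars_inter_Jrow, finsum_mem_empty] at hle
  have key : (1 : ℝ) ≤ 0 := by simpa using hle
  linarith

end Summit.MatrixMultiplication.MatrixMultiplication.Theorems.GradedPricing.Negative

end
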